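import Literature.Probability.RandomPlanarGeometry.SLEPointFlow
import Literature.Probability.RandomPlanarGeometry.SLEDerivRatioMartingale
import Literature.Probability.RandomPlanarGeometry.LoewnerCentredFlowIntegral
import Literature.Probability.RandomPlanarGeometry.SLERealFlowIto
import HarnessLib

/-!
# The SLE_κ flow of a point of `ℍ` stopped before swallowing: integral equations and the Itô form

Topic `Probability/RandomPlanarGeometry`; theorems and auxiliary definitions serving the
discharge of the Itô step of Rohde–Schramm's Lemma 6.3
(`Literature.Probability.RandomPlanarGeometry.sle_martingale_rsObservable`, file
`SLEDerivRatioMartingale`). For the SLE_κ driving function `W = √κ B` on the canonical space, a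
point `z` with `0 < im z`, and a stopping time `σ` of the raw Brownian filtration dominated by one
of the localizing times `ρₙ = slePointLocTime κ z n` of `SLEPointFlow` (so that on `[0, σ]` the flow
is alive, `yₜ ≥ im z/(n+2)` and `|Wₜ| ≤ n + 1`), this file records, for the stopped real processes
`x^σ, y^σ` (`xₜ + i yₜ = zₜ = gₜ(z) - Wₜ`, Rohde–Schramm (2005), proof of Lemma 6.3, p. 904):

* path regularity, adaptedness / progressive measurability, and the elementary bounds on `[0, σ]`;
* the three **integral equations** in the `timeIntegral`/`trunc` format of the tree's Itô calculus
  (`Literature.Analysis.FunctionSpaces.timeIntegral`, `.trunc`):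
  `x^σ_t = re z + ∫₀ᵗ 𝟙_{s≤σ} 2x_s/|z_s|² ds - √κ B_{t∧σ}` ("`dxₜ = 2xₜ|zₜ|⁻² dt - dξ(t)`", p. 907),
  `1/y^σ_t = 1/im z + ∫₀ᵗ 𝟙_{s≤σ} 2/(y_s|z_s|²) ds` ("`∂ₜ log yₜ = -2|zₜ|⁻²`", p. 904) and
  `ψ^a_{t∧σ} = 1 + ∫₀ᵗ 𝟙_{s≤σ} a ψ_s^a 4y_s²/|z_s|⁴ ds`, `ψ_{t∧σ} = exp ∫₀ᵗ 𝟙_{s≤σ} 4y_s²/|z_s|⁴ ds`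
  ("`∂ₜ log ψₜ = 4yₜ²|zₜ|⁻⁴`", eq. (6.3)), all pathwise from `LoewnerCentredFlowIntegral`;
* **`x^σ` is an Itô process** driven by the canonical Brownian motion with drift
  `𝟙_{s≤σ} 2x_s/|z_s|²` and diffusion coefficient `𝟙_{s≤σ}(-√κ)`
  (`isItoProcess_stoppedProcess_slePointRe`; same argument as
  `isItoProcess_stoppedProcess_sleRealFlowStop` of `SLERealFlowIto`);
* the random time `T ∧ ρₙ`, `T = sleCotArgExitTime κ z s` the exit time of the slope `|w| = |x/y|`
  from `[0, s)` (Rohde–Schramm's `T ∧ tₙ`, p. 905), **is a stopping time** of the raw Brownian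
  filtration (`isStoppingTime_sleCotArgLocTime`): it is `H ∧ ρₙ` for the hitting time `H` of
  `[0, ∞)` by the continuous adapted process `|x^{ρₙ}| - s y^{ρₙ}`.

## References

* S. Rohde, O. Schramm, *Basic properties of SLE*, Ann. of Math. 161 (2005), §2.1, proof of
  Lemma 6.3 (pp. 904–905), eq. (6.3).
* D. Revuz, M. Yor, *Continuous Martingales and Brownian Motion* (1999), Ch. I §4, Ch. IV §2–3.
-/

noncomputable section

open Set Filter MeasureTheory Complex
open _root_.Topology
open scoped NNReal ENNReal

namespace Literature.Probability.RandomPlanarGeometry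

open Loewner Literature.Probability.Process Literature.Analysis.FunctionSpaces

/-! ### The coefficient fields of the flow in the coordinates `(x, y)` -/

/-- `2x/(x² + y²) = re (2/(x + iy))`, the drift of `xₜ` ("`dxₜ = 2xₜ|zₜ|⁻² dt - dξ(t)`").
[cite: RohdeSchramm2005, Lemma 6.5 (proof)] -/
def loewnerReDrift (x y : ℝ) : ℝ := 2 * x / (x ^ 2 + y ^ 2)

/-- `2/(y (x² + y²))`, the time derivative of `1/yₜ` ("`∂ₜ yₜ = -2yₜ/|zₜ|²`").
[cite: RohdeSchramm2005, Lemma 6.3 (proof)] -/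
def loewnerInvImDrift (x y : ℝ) : ℝ := 2 / (y * (x ^ 2 + y ^ 2))

/-- `4y²/(x² + y²)²`, the time derivative of `log ψₜ` (eq. (6.3)). [cite: RohdeSchramm2005, eq. (6.3)] -/
def loewnerLogDerivRate (x y : ℝ) : ℝ := 4 * y ^ 2 / (x ^ 2 + y ^ 2) ^ 2

/-- Unfolding lemma. [folklore] -/
theorem loewnerReDrift_apply (x y : ℝ) : loewnerReDrift x y = 2 * x / (x ^ 2 + y ^ 2) := rfl

/-- Unfolding lemma. [folklore] -/
theorem loewnerInvImDrift_apply (x y : ℝ) : loewnerInvImDrift x y = 2 / (y * (x ^ 2 + y ^ 2)) := rfl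

/-- Unfolding lemma. [folklore] -/
theorem loewnerLogDerivRate_apply (x y : ℝ) :
    loewnerLogDerivRate x y = 4 * y ^ 2 / (x ^ 2 + y ^ 2) ^ 2 := rfl

/-- The three fields are Borel measurable functions of `(x, y)`. [folklore] -/
theorem measurable_loewnerReDrift : Measurable (Function.uncurry loewnerReDrift) :=
  (measurable_const.mul measurable_fst).div ((measurable_fst.pow_const 2).add (measurable_snd.pow_const 2))

/-- Measurability of `loewnerInvImDrift`. [folklore] -/
theorem measurable_loewnerInvImDrift : Measurable (Function.uncurry loewnerInvImDrift) :=
  measurable_const.div (measurable_snd.mul ((measurable_fst.pow_const 2).add (measurable_snd.pow_const 2)))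

/-- Measurability of `loewnerLogDerivRate`. [folklore] -/
theorem measurable_loewnerLogDerivRate : Measurable (Function.uncurry loewnerLogDerivRate) :=
  (measurable_const.mul (measurable_snd.pow_const 2)).div
    (((measurable_fst.pow_const 2).add (measurable_snd.pow_const 2)).pow_const 2)

/-- The rate is non-negative. [folklore] -/
theorem loewnerLogDerivRate_nonneg (x y : ℝ) : 0 ≤ loewnerLogDerivRate x y := by
  rw [loewnerLogDerivRate_apply]; positivity

/-- `4y²/(x²+y²)² ≤ 4/y²`. [folklore] -/
theorem loewnerLogDerivRate_le {x y : ℝ} (hy : 0 < y) : loewnerLogDerivRate x y ≤ 4 / y ^ 2 := by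
  rw [loewnerLogDerivRate_apply, div_le_div_iff₀ (by positivity) (by positivity)]
  have h1 : y ^ 2 ≤ x ^ 2 + y ^ 2 := by nlinarith [sq_nonneg x]
  have h2 : 0 ≤ x ^ 2 + y ^ 2 := by positivity
  nlinarith [mul_le_mul h1 h1 (by positivity) h2]

/-- In terms of a complex number `Z = x + iy`: `x² + y² = normSq Z`. [folklore] -/
theorem re_sq_add_im_sq (Z : ℂ) : Z.re ^ 2 + Z.im ^ 2 = Complex.normSq Z := by
  rw [Complex.normSq_apply]; ring

/-- `x² + y² = ‖Z‖²`. [folklore] -/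
theorem re_sq_add_im_sq_eq_norm_sq (Z : ℂ) : Z.re ^ 2 + Z.im ^ 2 = ‖Z‖ ^ 2 := by
  rw [re_sq_add_im_sq, Complex.sq_norm]

/-! ### A two-process composition rule for progressive measurability -/

section Progressive

variable {Ω : Type*} {m : MeasurableSpace Ω} {𝓕 : Filtration ℝ≥0 m}

/-- A jointly Borel function of two progressive real processes is progressive. [folklore] -/
theorem isStronglyProgressive_comp_pair {U V : ℝ≥0 → Ω → ℝ}
    (hU : IsStronglyProgressive 𝓕 U) (hV : IsStronglyProgressive 𝓕 V) {F : ℝ → ℝ → ℝ}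
    (hF : Measurable (Function.uncurry F)) :
    IsStronglyProgressive 𝓕 fun i ω ↦ F (U i ω) (V i ω) := by
  intro i
  have h1 : Measurable[Subtype.instMeasurableSpace.prod (𝓕 i)]
      (fun p : Set.Iic i × Ω ↦ (U p.1 p.2, V p.1 p.2)) :=
    Measurable.prodMk (m := Subtype.instMeasurableSpace.prod (𝓕 i)) (hU i).measurable (hV i).measurable
  exact (hF.comp h1).stronglyMeasurable

end Progressive

variable {κ : ℝ≥0} {z : ℂ} {n : ℕ} {σ : (ℝ≥0 → ℝ) → WithTop ℝ≥0}

/-! ### The stopped clock `t ∧ σ` below a localizing time -/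

section Clock

/-- For `σ ≤ ρₙ`, the stopped clock `t ∧ σ` is at most `ρₙ`. [folklore] -/
theorem coe_untopA_min_le_locTime (hσρ : ∀ ω, σ ω ≤ slePointLocTime κ z n ω) (t : ℝ≥0)
    (ω : ℝ≥0 → ℝ) :
    (((min (t : WithTop ℝ≥0) (σ ω)).untopA : ℝ≥0) : WithTop ℝ≥0) ≤ slePointLocTime κ z n ω :=
  (coe_untopA_min_le t (σ ω)).trans (hσρ ω)

/-- For `σ ≤ ρₙ`, the stopped clock is before the swallowing time. [folklore] -/
theorem coe_untopA_min_lt_swallowingTime (hz : 0 < z.im)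
    (hσρ : ∀ ω, σ ω ≤ slePointLocTime κ z n ω) (t : ℝ≥0) (ω : ℝ≥0 → ℝ) :
    (((min (t : WithTop ℝ≥0) (σ ω)).untopA : ℝ≥0) : WithTop ℝ≥0) <
      swallowingTime (sleDriving κ ω) z :=
  coe_lt_swallowingTime_of_le_locTime hz (coe_untopA_min_le_locTime hσρ t ω)

/-- The stopped clock is at most `n + 1` (`ρₙ ≤ n + 1`). [folklore] -/
theorem untopA_min_le_nat_add_one (hσρ : ∀ ω, σ ω ≤ slePointLocTime κ z n ω) (t : ℝ≥0)
    (ω : ℝ≥0 → ℝ) : ((min (t : WithTop ℝ≥0) (σ ω)).untopA : ℝ≥0) ≤ (n : ℝ≥0) + 1 :=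
  WithTop.coe_le_coe.1 ((coe_untopA_min_le_locTime hσρ t ω).trans (slePointLocTime_le n ω))

/-- A real time `r ∈ [0, t ∧ σ]` is, clamped to `ℝ≥0`, at most `σ`. [folklore] -/
theorem coe_toNNReal_le_of_le_untopA_min {t : ℝ≥0} {ω : ℝ≥0 → ℝ} {r : ℝ}
    (hr : r ≤ ((min (t : WithTop ℝ≥0) (σ ω)).untopA : ℝ≥0)) :
    ((r.toNNReal : ℝ≥0) : WithTop ℝ≥0) ≤ σ ω :=
  (WithTop.coe_le_coe.2 (Real.toNNReal_le_iff_le_coe.2 hr)).trans (coe_untopA_min_le t (σ ω))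

end Clock

/-! ### The stopped processes `x^σ`, `y^σ`: values, bounds, regularity, adaptedness -/

section Stopped

/-- `x^σ_t = re z_{t∧σ}` (`rfl`). [folklore] -/
theorem stoppedProcess_slePointRe_eq (t : ℝ≥0) (ω : ℝ≥0 → ℝ) :
    stoppedProcess (slePointRe κ z) σ t ω =
      (centredMap (sleDriving κ ω) ((min (t : WithTop ℝ≥0) (σ ω)).untopA) z).re := rfl

/-- `y^σ_t = im z_{t∧σ}` for `σ ≤ ρₙ` (the clock is before the swallowing time). [folklore] -/
theorem stoppedProcess_slePointIm_eq (hz : 0 < z.im) (hσρ : ∀ ω, σ ω ≤ slePointLocTime κ z n ω)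
    (t : ℝ≥0) (ω : ℝ≥0 → ℝ) :
    stoppedProcess (slePointIm κ z) σ t ω =
      (centredMap (sleDriving κ ω) ((min (t : WithTop ℝ≥0) (σ ω)).untopA) z).im := by
  rw [stoppedProcess, slePointIm_of_lt (coe_untopA_min_lt_swallowingTime hz hσρ t ω)]

/-- **`y^σ ≥ im z/(n+2)`** for `σ ≤ ρₙ`. [folklore] -/
theorem level_le_stoppedProcess_slePointIm (hz : 0 < z.im)
    (hσρ : ∀ ω, σ ω ≤ slePointLocTime κ z n ω) (t : ℝ≥0) (ω : ℝ≥0 → ℝ) :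
    z.im / (n + 2) ≤ stoppedProcess (slePointIm κ z) σ t ω :=
  level_le_slePointIm hz (coe_untopA_min_le_locTime hσρ t ω)

/-- `y^σ > 0` for `σ ≤ ρₙ`. [folklore] -/
theorem stoppedProcess_slePointIm_pos (hz : 0 < z.im)
    (hσρ : ∀ ω, σ ω ≤ slePointLocTime κ z n ω) (t : ℝ≥0) (ω : ℝ≥0 → ℝ) :
    0 < stoppedProcess (slePointIm κ z) σ t ω :=
  (level_pos_lt hz n).1.trans_le (level_le_stoppedProcess_slePointIm hz hσρ t ω)

/-- `y^σ ≤ im z`. [folklore] -/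
theorem stoppedProcess_slePointIm_le (hz : 0 < z.im)
    (hσρ : ∀ ω, σ ω ≤ slePointLocTime κ z n ω) (t : ℝ≥0) (ω : ℝ≥0 → ℝ) :
    stoppedProcess (slePointIm κ z) σ t ω ≤ z.im := by
  rw [stoppedProcess_slePointIm_eq hz hσρ]
  exact im_centredMap_le (continuous_sleDriving κ ω) hz (coe_untopA_min_lt_swallowingTime hz hσρ t ω)

/-- `(x^σ)² + (y^σ)² = |z_{t∧σ}|²`. [folklore] -/
theorem sq_add_sq_stopped_eq_normSq (hz : 0 < z.im) (hσρ : ∀ ω, σ ω ≤ slePointLocTime κ z n ω)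
    (t : ℝ≥0) (ω : ℝ≥0 → ℝ) :
    stoppedProcess (slePointRe κ z) σ t ω ^ 2 + stoppedProcess (slePointIm κ z) σ t ω ^ 2 =
      Complex.normSq (centredMap (sleDriving κ ω) ((min (t : WithTop ℝ≥0) (σ ω)).untopA) z) := by
  rw [stoppedProcess_slePointRe_eq, stoppedProcess_slePointIm_eq hz hσρ, re_sq_add_im_sq]

/-- `(x^σ)² + (y^σ)² ≥ (im z/(n+2))² > 0`. [folklore] -/
theorem sq_level_le_sq_add_sq_stopped (hz : 0 < z.im) (hσρ : ∀ ω, σ ω ≤ slePointLocTime κ z n ω)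
    (t : ℝ≥0) (ω : ℝ≥0 → ℝ) :
    (z.im / (n + 2)) ^ 2 ≤
      stoppedProcess (slePointRe κ z) σ t ω ^ 2 + stoppedProcess (slePointIm κ z) σ t ω ^ 2 := by
  rw [sq_add_sq_stopped_eq_normSq hz hσρ]
  exact sq_level_le_normSq_centredMap hz (coe_untopA_min_le_locTime hσρ t ω)

/-- `(x^σ)² + (y^σ)² > 0`. [folklore] -/
theorem sq_add_sq_stopped_pos (hz : 0 < z.im) (hσρ : ∀ ω, σ ω ≤ slePointLocTime κ z n ω)
    (t : ℝ≥0) (ω : ℝ≥0 → ℝ) :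
    0 < stoppedProcess (slePointRe κ z) σ t ω ^ 2 + stoppedProcess (slePointIm κ z) σ t ω ^ 2 :=
  (pow_pos (level_pos_lt hz n).1 2).trans_le (sq_level_le_sq_add_sq_stopped hz hσρ t ω)

/-- The slope along the stopped flow: `x^σ/y^σ = w_{t∧σ}`. [folklore] -/
theorem stopped_div_eq_cotArg (hz : 0 < z.im) (hσρ : ∀ ω, σ ω ≤ slePointLocTime κ z n ω)
    (t : ℝ≥0) (ω : ℝ≥0 → ℝ) :
    stoppedProcess (slePointRe κ z) σ t ω / stoppedProcess (slePointIm κ z) σ t ω =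
      cotArg (sleDriving κ ω) z ((min (t : WithTop ℝ≥0) (σ ω)).untopA) := by
  rw [stoppedProcess_slePointRe_eq, stoppedProcess_slePointIm_eq hz hσρ, cotArg_apply]

/-- **Every path of `x^σ` is continuous** (`x` is continuous before `τ(z)` and the clock stays in
`[0, ρₙ] ⊂ [0, τ(z))`). [folklore] -/
theorem continuous_stoppedProcess_slePointRe (hz : 0 < z.im)
    (hσρ : ∀ ω, σ ω ≤ slePointLocTime κ z n ω) (ω : ℝ≥0 → ℝ) :
    Continuous fun t ↦ stoppedProcess (slePointRe κ z) σ t ω :=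
  (continuousOn_slePointRe hz ω).comp_continuous (continuous_untopA_min_coe (σ ω))
    fun t ↦ coe_untopA_min_lt_swallowingTime hz hσρ t ω

/-- Every path of `y^σ` is continuous. [folklore] -/
theorem continuous_stoppedProcess_slePointIm (hz : 0 < z.im) (σ : (ℝ≥0 → ℝ) → WithTop ℝ≥0)
    (ω : ℝ≥0 → ℝ) : Continuous fun t ↦ stoppedProcess (slePointIm κ z) σ t ω :=
  continuous_stoppedProcess_path (continuous_slePointIm hz ω) σ

/-- `x^σ` is progressively measurable for a stopping time `σ`. [folklore] -/
theorem isStronglyProgressive_stoppedProcess_slePointRe (hz : 0 < z.im)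
    (hσ : IsStoppingTime brownianFiltration σ) :
    IsStronglyProgressive brownianFiltration (stoppedProcess (slePointRe κ z) σ) :=
  (isStronglyProgressive_slePointRe κ hz).stoppedProcess hσ

/-- `y^σ` is progressively measurable for a stopping time `σ`. [folklore] -/
theorem isStronglyProgressive_stoppedProcess_slePointIm (hz : 0 < z.im)
    (hσ : IsStoppingTime brownianFiltration σ) :
    IsStronglyProgressive brownianFiltration (stoppedProcess (slePointIm κ z) σ) :=
  (isStronglyProgressive_slePointIm κ hz).stoppedProcess hσ

/-- `x^σ` is strongly adapted. [folklore] -/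
theorem stronglyAdapted_stoppedProcess_slePointRe (hz : 0 < z.im)
    (hσ : IsStoppingTime brownianFiltration σ) :
    StronglyAdapted brownianFiltration (stoppedProcess (slePointRe κ z) σ) :=
  (isStronglyProgressive_stoppedProcess_slePointRe hz hσ).stronglyAdapted

/-- `y^σ` is strongly adapted. [folklore] -/
theorem stronglyAdapted_stoppedProcess_slePointIm (hz : 0 < z.im)
    (hσ : IsStoppingTime brownianFiltration σ) :
    StronglyAdapted brownianFiltration (stoppedProcess (slePointIm κ z) σ) :=
  (isStronglyProgressive_stoppedProcess_slePointIm hz hσ).stronglyAdapted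

/-- `x^σ_0 = re z`. [folklore] -/
theorem stoppedProcess_slePointRe_zero (hz : 0 < z.im) (ω : ℝ≥0 → ℝ) :
    stoppedProcess (slePointRe κ z) σ 0 ω = z.re := by
  rw [stoppedProcess_eq_of_le (by exact_mod_cast bot_le : ((0 : ℝ≥0) : WithTop ℝ≥0) ≤ σ ω),
    slePointRe, centredMap_zero (continuous_sleDriving κ ω) (ne_driving_of_im_pos hz 0),
    sleDriving_zero, Complex.ofReal_zero, sub_zero]

/-- `y^σ_0 = im z`. [folklore] -/
theorem stoppedProcess_slePointIm_zero (hz : 0 < z.im) (ω : ℝ≥0 → ℝ) :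
    stoppedProcess (slePointIm κ z) σ 0 ω = z.im := by
  rw [stoppedProcess_eq_of_le (by exact_mod_cast bot_le : ((0 : ℝ≥0) : WithTop ℝ≥0) ≤ σ ω),
    slePointIm_apply, imFlowStop_zero (continuous_sleDriving κ ω) hz]

end Stopped

/-! ### `T ∧ ρₙ` is a stopping time -/

section LocTime

variable (κ z) in
/-- **Rohde–Schramm's `T ∧ tₙ`** (p. 905): the exit time `T = sleCotArgExitTime κ z s` of the slope
`|w|` from `[0, s)`, capped by the localizing time `ρₙ = slePointLocTime κ z n`.
[cite: RohdeSchramm2005, Lemma 6.3 (proof)] -/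
def sleCotArgLocTime (s : ℝ) (n : ℕ) (ω : ℝ≥0 → ℝ) : WithTop ℝ≥0 :=
  min (sleCotArgExitTime κ z s ω) (slePointLocTime κ z n ω)

/-- `T ∧ ρₙ ≤ ρₙ`. [folklore] -/
theorem sleCotArgLocTime_le_locTime (s : ℝ) (n : ℕ) (ω : ℝ≥0 → ℝ) :
    sleCotArgLocTime κ z s n ω ≤ slePointLocTime κ z n ω := min_le_right _ _

/-- `T ∧ ρₙ ≤ T`. [folklore] -/
theorem sleCotArgLocTime_le_exitTime (s : ℝ) (n : ℕ) (ω : ℝ≥0 → ℝ) :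
    sleCotArgLocTime κ z s n ω ≤ sleCotArgExitTime κ z s ω := min_le_left _ _

variable (κ z) in
/-- The continuous adapted process `|x^{ρₙ}| - s y^{ρₙ}` whose entrance time in `[0, ∞)`, capped
by `ρₙ`, is `T ∧ ρₙ`. [folklore] -/
def sleSlopeGauge (s : ℝ) (n : ℕ) (t : ℝ≥0) (ω : ℝ≥0 → ℝ) : ℝ :=
  |stoppedProcess (slePointRe κ z) (slePointLocTime κ z n) t ω| -
    s * stoppedProcess (slePointIm κ z) (slePointLocTime κ z n) t ω

/-- The gauge is adapted. [folklore] -/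
theorem adapted_sleSlopeGauge (hz : 0 < z.im) (s : ℝ) (n : ℕ) :
    Adapted brownianFiltration (sleSlopeGauge κ z s n) := by
  intro t
  have h1 : Measurable[brownianFiltration t]
      (stoppedProcess (slePointRe κ z) (slePointLocTime κ z n) t) :=
    (stronglyAdapted_stoppedProcess_slePointRe hz (isStoppingTime_slePointLocTime κ hz n) t).measurable
  have h2 : Measurable[brownianFiltration t]
      (stoppedProcess (slePointIm κ z) (slePointLocTime κ z n) t) :=
    (stronglyAdapted_stoppedProcess_slePointIm hz (isStoppingTime_slePointLocTime κ hz n) t).measurable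
  exact (continuous_abs.measurable.comp h1).sub (h2.const_mul s)

/-- The gauge has continuous paths. [folklore] -/
theorem continuous_sleSlopeGauge (hz : 0 < z.im) (s : ℝ) (n : ℕ) (ω : ℝ≥0 → ℝ) :
    Continuous fun t ↦ sleSlopeGauge κ z s n t ω :=
  (continuous_stoppedProcess_slePointRe hz (fun _ ↦ le_rfl) ω).abs.sub
    (continuous_const.mul (continuous_stoppedProcess_slePointIm hz _ ω))

/-- Up to `ρₙ`, the gauge is non-negative exactly when `s ≤ |wₜ|`. [folklore] -/
theorem sleSlopeGauge_nonneg_iff (hz : 0 < z.im) {s : ℝ} {n : ℕ} {t : ℝ≥0} {ω : ℝ≥0 → ℝ}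
    (ht : (t : WithTop ℝ≥0) ≤ slePointLocTime κ z n ω) :
    0 ≤ sleSlopeGauge κ z s n t ω ↔ s ≤ |cotArg (sleDriving κ ω) z t| := by
  have hy := stoppedProcess_slePointIm_pos hz (σ := slePointLocTime κ z n) (fun _ ↦ le_rfl) t ω
  have hw := stopped_div_eq_cotArg hz (σ := slePointLocTime κ z n) (fun _ ↦ le_rfl) t ω
  rw [stoppedProcess_eq_of_le ht] at hy hw
  rw [sleSlopeGauge, stoppedProcess_eq_of_le ht, stoppedProcess_eq_of_le ht,
    show (((min (t : WithTop ℝ≥0) (slePointLocTime κ z n ω)).untopA : ℝ≥0)) = t by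
      rw [min_eq_left ht]; rfl] at *
  rw [← hw, abs_div, abs_of_pos hy, le_div_iff₀ hy, sub_nonneg]

/-- **`T ∧ ρₙ = H ∧ ρₙ`** for the entrance time `H` of the gauge in `[0, ∞)`. [folklore] -/
theorem sleCotArgLocTime_eq_min_hittingAfter (hz : 0 < z.im) (s : ℝ) (n : ℕ) (ω : ℝ≥0 → ℝ) :
    sleCotArgLocTime κ z s n ω =
      min (hittingAfter (sleSlopeGauge κ z s n) (Ici 0) 0 ω) (slePointLocTime κ z n ω) := by
  change min (sleCotArgExitTime κ z s ω) (slePointLocTime κ z n ω) = _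
  set H := hittingAfter (sleSlopeGauge κ z s n) (Ici 0) 0 ω with hHdef
  set ρ := slePointLocTime κ z n ω with hρdef
  set T := sleCotArgExitTime κ z s ω with hTdef
  have hW := continuous_sleDriving κ ω
  refine le_antisymm ?_ ?_
  · -- `T ∧ ρ ≤ H ∧ ρ`: it suffices that `T ∧ ρ ≤ H`
    refine le_min ?_ (min_le_right _ _)
    induction hH : H using WithTop.recTopCoe with
    | top => exact le_top
    | coe h₀ =>
      have hmem : sleSlopeGauge κ z s n h₀ ω ∈ Ici (0 : ℝ) :=
        mem_of_hittingAfter_zero_eq_coe isClosed_Ici (continuous_sleSlopeGauge hz s n ω) hH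
      rcases le_or_gt ρ (h₀ : WithTop ℝ≥0) with hρh | hρh
      · exact (min_le_right _ _).trans hρh
      · have hle : ((h₀ : ℝ≥0) : WithTop ℝ≥0) ≤ slePointLocTime κ z n ω := hρh.le
        have hs : s ≤ |cotArg (sleDriving κ ω) z h₀| := (sleSlopeGauge_nonneg_iff hz hle).1 hmem
        exact (min_le_left _ _).trans
          (cotArgExitTime_le (sleDriving κ ω) z (coe_lt_swallowingTime_of_le_locTime hz hle) hs)
  · -- `H ∧ ρ ≤ T ∧ ρ`: it suffices that `H ∧ ρ ≤ T`
    refine le_min ?_ (min_le_right _ _)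
    induction hT : T using WithTop.recTopCoe with
    | top => exact le_top
    | coe t₀ =>
      have hT' : cotArgExitTime (sleDriving κ ω) z s = t₀ := hT
      obtain ⟨t₁, ht₁, hlt, hs⟩ := exists_cotArgExitTime_eq_coe hW hz (s := s)
        (by rw [hT']; exact WithTop.coe_ne_top)
      have h01 : t₀ = t₁ := WithTop.coe_eq_coe.1 (hT'.symm.trans ht₁)
      subst h01
      rcases le_or_gt ρ (t₀ : WithTop ℝ≥0) with hρt | hρt
      · exact (min_le_right _ _).trans hρt
      · have hle : ((t₀ : ℝ≥0) : WithTop ℝ≥0) ≤ slePointLocTime κ z n ω := hρt.le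
        have hmem : sleSlopeGauge κ z s n t₀ ω ∈ Ici (0 : ℝ) :=
          (sleSlopeGauge_nonneg_iff hz hle).2 hs
        exact (min_le_left _ _).trans (hittingAfter_le_of_mem bot_le hmem)

/-- **`T ∧ ρₙ` is a stopping time** of the raw Brownian filtration. Rohde–Schramm (2005), p. 905
("Set `t̄ₙ := T ∧ tₙ`"). [cite: RohdeSchramm2005, Lemma 6.3 (proof)] -/
theorem isStoppingTime_sleCotArgLocTime (hz : 0 < z.im) (s : ℝ) (n : ℕ) :
    IsStoppingTime brownianFiltration (sleCotArgLocTime κ z s n) := by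
  have heq : sleCotArgLocTime κ z s n = fun ω ↦
      min (hittingAfter (sleSlopeGauge κ z s n) (Ici 0) 0 ω) (slePointLocTime κ z n ω) :=
    funext fun ω ↦ sleCotArgLocTime_eq_min_hittingAfter hz s n ω
  rw [heq]
  exact (isStoppingTime_hittingAfter_of_continuous (adapted_sleSlopeGauge hz s n)
    (continuous_sleSlopeGauge hz s n) isClosed_Ici).min (isStoppingTime_slePointLocTime κ hz n)

/-- On `[0, T ∧ ρₙ]` the slope is bounded by `s`, provided `|w₀| < s`. [folklore] -/
theorem abs_cotArg_le_of_le_sleCotArgLocTime (hz : 0 < z.im) {s : ℝ} (h0 : |z.re / z.im| < s)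
    {n : ℕ} {ω : ℝ≥0 → ℝ} {t : ℝ≥0} (ht : (t : WithTop ℝ≥0) ≤ sleCotArgLocTime κ z s n ω) :
    |cotArg (sleDriving κ ω) z t| ≤ s := by
  have h0' : |cotArg (sleDriving κ ω) z 0| < s := by rwa [cotArg_sleDriving_zero κ ω hz]
  exact abs_cotArg_le_of_le_cotArgExitTime (continuous_sleDriving κ ω) hz h0'
    (coe_lt_swallowingTime_of_le_locTime hz (ht.trans (sleCotArgLocTime_le_locTime s n ω)))
    (ht.trans (sleCotArgLocTime_le_exitTime s n ω))

end LocTime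

/-! ### Continuity of the coefficient fields along positive-`y` paths -/

section FieldContinuity

variable {α : Type*} [TopologicalSpace α] {f g : α → ℝ}

/-- `r ↦ 2f/(f² + g²)` is continuous when `f, g` are and `g > 0`. [folklore] -/
theorem continuous_loewnerReDrift_comp (hf : Continuous f) (hg : Continuous g) (hpos : ∀ r, 0 < g r) :
    Continuous fun r ↦ loewnerReDrift (f r) (g r) := by
  simp only [loewnerReDrift_apply]
  exact (continuous_const.mul hf).div ((hf.pow 2).add (hg.pow 2)) fun r ↦ by
    have := hpos r; positivity

/-- `r ↦ 2/(g (f² + g²))` is continuous when `f, g` are and `g > 0`. [folklore] -/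
theorem continuous_loewnerInvImDrift_comp (hf : Continuous f) (hg : Continuous g) (hpos : ∀ r, 0 < g r) :
    Continuous fun r ↦ loewnerInvImDrift (f r) (g r) := by
  simp only [loewnerInvImDrift_apply]
  exact continuous_const.div (hg.mul ((hf.pow 2).add (hg.pow 2))) fun r ↦ by
    have := hpos r; positivity

/-- `r ↦ 4g²/(f² + g²)²` is continuous when `f, g` are and `g > 0`. [folklore] -/
theorem continuous_loewnerLogDerivRate_comp (hf : Continuous f) (hg : Continuous g)
    (hpos : ∀ r, 0 < g r) : Continuous fun r ↦ loewnerLogDerivRate (f r) (g r) := by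
  simp only [loewnerLogDerivRate_apply]
  exact (continuous_const.mul (hg.pow 2)).div (((hf.pow 2).add (hg.pow 2)).pow 2) fun r ↦ by
    have := hpos r; positivity

end FieldContinuity

/-! ### The integral equations for `x^σ` and `1/y^σ` -/

section Integral

/-- **`x^σ_t = re z + ∫₀ᵗ 𝟙_{s≤σ} 2x_s/|z_s|² ds - √κ B_{t∧σ}`** (pathwise, `σ ≤ ρₙ`): the real part
of the chordal Loewner equation integrated along the flow of `z` (`Loewner.re_centredMap_eq`), read
at the stopped clock. Rohde–Schramm (2005), proof of Lemma 6.5: "`dxₜ = 2xₜ|zₜ|⁻² dt - dξ(t)`".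
[cite: RohdeSchramm2005, Lemma 6.3 (proof)] -/
theorem stoppedProcess_slePointRe_eq_integral (hz : 0 < z.im)
    (hσρ : ∀ ω, σ ω ≤ slePointLocTime κ z n ω) (t : ℝ≥0) (ω : ℝ≥0 → ℝ) :
    stoppedProcess (slePointRe κ z) σ t ω =
      z.re + timeIntegral (trunc σ fun s ω ↦ loewnerReDrift (stoppedProcess (slePointRe κ z) σ s ω)
        (stoppedProcess (slePointIm κ z) σ s ω)) t ω +
      -Real.sqrt κ * brownian ((min (t : WithTop ℝ≥0) (σ ω)).untopA) ω := by
  set u : ℝ≥0 := (min (t : WithTop ℝ≥0) (σ ω)).untopA with hu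
  have hW := continuous_sleDriving κ ω
  have huT := coe_untopA_min_lt_swallowingTime hz hσρ t ω
  have hint : timeIntegral (trunc σ fun s ω ↦ loewnerReDrift (stoppedProcess (slePointRe κ z) σ s ω)
      (stoppedProcess (slePointIm κ z) σ s ω)) t ω =
      ∫ r in (0 : ℝ)..u, 2 * (centredMap (sleDriving κ ω) r.toNNReal z).re /
        ‖centredMap (sleDriving κ ω) r.toNNReal z‖ ^ 2 := by
    rw [timeIntegral_trunc]
    simp only [timeIntegral]
    refine intervalIntegral.integral_congr fun r hr ↦ ?_
    rw [uIcc_of_le (NNReal.coe_nonneg _)] at hr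
    have hrσ : ((r.toNNReal : ℝ≥0) : WithTop ℝ≥0) ≤ σ ω := coe_toNNReal_le_of_le_untopA_min hr.2
    have hrT := coe_lt_swallowingTime_of_le_locTime hz (hrσ.trans (hσρ ω))
    simp only [stoppedProcess_eq_of_le hrσ, loewnerReDrift_apply]
    rw [slePointIm_of_lt hrT, slePointRe, re_sq_add_im_sq_eq_norm_sq]
  rw [hint, stoppedProcess_slePointRe_eq, ← hu, re_centredMap_eq hW hz huT, sleDriving_apply]
  ring

/-- **`1/y^σ_t = 1/im z + ∫₀ᵗ 𝟙_{s≤σ} 2/(y_s|z_s|²) ds`** (pathwise, `σ ≤ ρₙ`;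
`Loewner.inv_im_centredMap_eq` at the stopped clock). Rohde–Schramm (2005), proof of Lemma 6.3
("`∂ₜ log yₜ = -2/|zₜ|²`", p. 904). [cite: RohdeSchramm2005, Lemma 6.3 (proof)] -/
theorem inv_stoppedProcess_slePointIm_eq_integral (hz : 0 < z.im)
    (hσρ : ∀ ω, σ ω ≤ slePointLocTime κ z n ω) (t : ℝ≥0) (ω : ℝ≥0 → ℝ) :
    (stoppedProcess (slePointIm κ z) σ t ω)⁻¹ =
      (z.im)⁻¹ + timeIntegral (trunc σ fun s ω ↦ loewnerInvImDrift
        (stoppedProcess (slePointRe κ z) σ s ω) (stoppedProcess (slePointIm κ z) σ s ω)) t ω := by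
  set u : ℝ≥0 := (min (t : WithTop ℝ≥0) (σ ω)).untopA with hu
  have hW := continuous_sleDriving κ ω
  have huT := coe_untopA_min_lt_swallowingTime hz hσρ t ω
  have hint : timeIntegral (trunc σ fun s ω ↦ loewnerInvImDrift (stoppedProcess (slePointRe κ z) σ s ω)
      (stoppedProcess (slePointIm κ z) σ s ω)) t ω =
      ∫ r in (0 : ℝ)..u, 2 / ((centredMap (sleDriving κ ω) r.toNNReal z).im *
        ‖centredMap (sleDriving κ ω) r.toNNReal z‖ ^ 2) := by
    rw [timeIntegral_trunc]
    simp only [timeIntegral]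
    refine intervalIntegral.integral_congr fun r hr ↦ ?_
    rw [uIcc_of_le (NNReal.coe_nonneg _)] at hr
    have hrσ : ((r.toNNReal : ℝ≥0) : WithTop ℝ≥0) ≤ σ ω := coe_toNNReal_le_of_le_untopA_min hr.2
    have hrT := coe_lt_swallowingTime_of_le_locTime hz (hrσ.trans (hσρ ω))
    simp only [stoppedProcess_eq_of_le hrσ, loewnerInvImDrift_apply]
    rw [slePointIm_of_lt hrT, slePointRe, re_sq_add_im_sq_eq_norm_sq]
  rw [hint, stoppedProcess_slePointIm_eq hz hσρ, ← hu, inv_im_centredMap_eq hW hz huT]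

/-- The drift path `r ↦ 𝟙_{r≤σ} 2x_r/|z_r|²` is locally integrable (continuous integrand). [folklore] -/
theorem integrableOn_trunc_loewnerReDrift (hz : 0 < z.im) (hσρ : ∀ ω, σ ω ≤ slePointLocTime κ z n ω)
    (ω : ℝ≥0 → ℝ) (S : Set ℝ) (hS : IsCompact S) :
    IntegrableOn (fun r : ℝ ↦ trunc σ (fun s ω ↦ loewnerReDrift (stoppedProcess (slePointRe κ z) σ s ω)
      (stoppedProcess (slePointIm κ z) σ s ω)) r.toNNReal ω) S := by
  refine integrableOn_trunc ?_
  have hc : Continuous fun r : ℝ ↦ loewnerReDrift (stoppedProcess (slePointRe κ z) σ r.toNNReal ω)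
      (stoppedProcess (slePointIm κ z) σ r.toNNReal ω) :=
    continuous_loewnerReDrift_comp
      ((continuous_stoppedProcess_slePointRe hz hσρ ω).comp continuous_real_toNNReal)
      ((continuous_stoppedProcess_slePointIm hz σ ω).comp continuous_real_toNNReal)
      fun r ↦ stoppedProcess_slePointIm_pos hz hσρ _ ω
  exact hc.continuousOn.integrableOn_compact hS

/-- The path `r ↦ 𝟙_{r≤σ} 2/(y_r|z_r|²)` is locally integrable. [folklore] -/
theorem integrableOn_trunc_loewnerInvImDrift (hz : 0 < z.im)
    (hσρ : ∀ ω, σ ω ≤ slePointLocTime κ z n ω) (ω : ℝ≥0 → ℝ) (S : Set ℝ) (hS : IsCompact S) :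
    IntegrableOn (fun r : ℝ ↦ trunc σ (fun s ω ↦ loewnerInvImDrift
      (stoppedProcess (slePointRe κ z) σ s ω) (stoppedProcess (slePointIm κ z) σ s ω)) r.toNNReal ω)
      S := by
  refine integrableOn_trunc ?_
  have hc : Continuous fun r : ℝ ↦ loewnerInvImDrift (stoppedProcess (slePointRe κ z) σ r.toNNReal ω)
      (stoppedProcess (slePointIm κ z) σ r.toNNReal ω) :=
    continuous_loewnerInvImDrift_comp
      ((continuous_stoppedProcess_slePointRe hz hσρ ω).comp continuous_real_toNNReal)
      ((continuous_stoppedProcess_slePointIm hz σ ω).comp continuous_real_toNNReal)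
      fun r ↦ stoppedProcess_slePointIm_pos hz hσρ _ ω
  exact hc.continuousOn.integrableOn_compact hS

/-- The path `r ↦ 𝟙_{r≤σ} 4y_r²/|z_r|⁴` is locally integrable. [folklore] -/
theorem integrableOn_trunc_loewnerLogDerivRate (hz : 0 < z.im)
    (hσρ : ∀ ω, σ ω ≤ slePointLocTime κ z n ω) (ω : ℝ≥0 → ℝ) (S : Set ℝ) (hS : IsCompact S) :
    IntegrableOn (fun r : ℝ ↦ trunc σ (fun s ω ↦ loewnerLogDerivRate
      (stoppedProcess (slePointRe κ z) σ s ω) (stoppedProcess (slePointIm κ z) σ s ω)) r.toNNReal ω)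
      S := by
  refine integrableOn_trunc ?_
  have hc : Continuous fun r : ℝ ↦ loewnerLogDerivRate (stoppedProcess (slePointRe κ z) σ r.toNNReal ω)
      (stoppedProcess (slePointIm κ z) σ r.toNNReal ω) :=
    continuous_loewnerLogDerivRate_comp
      ((continuous_stoppedProcess_slePointRe hz hσρ ω).comp continuous_real_toNNReal)
      ((continuous_stoppedProcess_slePointIm hz σ ω).comp continuous_real_toNNReal)
      fun r ↦ stoppedProcess_slePointIm_pos hz hσρ _ ω
  exact hc.continuousOn.integrableOn_compact hS

/-- The three stopped coefficient processes are progressively measurable for a stopping time `σ`.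
[folklore] -/
theorem isStronglyProgressive_loewnerReDrift_stopped (hz : 0 < z.im)
    (hσ : IsStoppingTime brownianFiltration σ) :
    IsStronglyProgressive brownianFiltration fun s ω ↦ loewnerReDrift
      (stoppedProcess (slePointRe κ z) σ s ω) (stoppedProcess (slePointIm κ z) σ s ω) :=
  isStronglyProgressive_comp_pair (isStronglyProgressive_stoppedProcess_slePointRe hz hσ)
    (isStronglyProgressive_stoppedProcess_slePointIm hz hσ) measurable_loewnerReDrift

/-- Progressivity of the stopped `2/(y|z|²)`. [folklore] -/
theorem isStronglyProgressive_loewnerInvImDrift_stopped (hz : 0 < z.im)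
    (hσ : IsStoppingTime brownianFiltration σ) :
    IsStronglyProgressive brownianFiltration fun s ω ↦ loewnerInvImDrift
      (stoppedProcess (slePointRe κ z) σ s ω) (stoppedProcess (slePointIm κ z) σ s ω) :=
  isStronglyProgressive_comp_pair (isStronglyProgressive_stoppedProcess_slePointRe hz hσ)
    (isStronglyProgressive_stoppedProcess_slePointIm hz hσ) measurable_loewnerInvImDrift

/-- Progressivity of the stopped rate `4y²/|z|⁴`. [folklore] -/
theorem isStronglyProgressive_loewnerLogDerivRate_stopped (hz : 0 < z.im)
    (hσ : IsStoppingTime brownianFiltration σ) :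
    IsStronglyProgressive brownianFiltration fun s ω ↦ loewnerLogDerivRate
      (stoppedProcess (slePointRe κ z) σ s ω) (stoppedProcess (slePointIm κ z) σ s ω) :=
  isStronglyProgressive_comp_pair (isStronglyProgressive_stoppedProcess_slePointRe hz hσ)
    (isStronglyProgressive_stoppedProcess_slePointIm hz hσ) measurable_loewnerLogDerivRate

end Integral

/-! ### The ratio `ψ = (im z)|gₜ'(z)|/yₜ` along the stopped clock -/

section Psi

variable (κ z) in
/-- Rohde–Schramm's ratio **`ψₜ = ŷ |gₜ'(ẑ)| / yₜ`** for the SLE_κ flow of `z`, as a process on the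
canonical space (`Loewner.derivRatio` of the driving function `√κ B(ω)`; junk from `τ(z)` on).
This is the process form `(t, ω) ↦ …` (the argument order `MeasureTheory.stoppedProcess` needs) of
`Literature.Probability.RandomPlanarGeometry.sleDerivRatio κ ω z t` of `SLETraceDensity`: the two
agree definitionally (`slePointPsi_eq_sleDerivRatio`), so the `sleDerivRatio` API
(`one_le_sleDerivRatio`, `monotone_sleDerivRatio`, …) transfers by `rfl`.
[cite: RohdeSchramm2005, Lemma 6.3 (proof)] -/
def slePointPsi (t : ℝ≥0) (ω : ℝ≥0 → ℝ) : ℝ :=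
  derivRatio (sleDriving κ ω) z t

/-- Unfolding of `slePointPsi`. [folklore] -/
theorem slePointPsi_apply (t : ℝ≥0) (ω : ℝ≥0 → ℝ) :
    slePointPsi κ z t ω = derivRatio (sleDriving κ ω) z t := rfl

/-- **`slePointPsi` is `sleDerivRatio` with the process argument order** (`rfl`: both unfold to
`Loewner.derivRatio (sleDriving κ ω) z t`, `sleMap κ ω t = Loewner.map (sleDriving κ ω) t`).
[folklore] -/
theorem slePointPsi_eq_sleDerivRatio (t : ℝ≥0) (ω : ℝ≥0 → ℝ) :
    slePointPsi κ z t ω = sleDerivRatio κ ω z t := rfl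

/-- The stopped ratio in terms of `sleDerivRatio`. [folklore] -/
theorem stoppedProcess_slePointPsi_eq_sleDerivRatio (t : ℝ≥0) (ω : ℝ≥0 → ℝ) :
    stoppedProcess (slePointPsi κ z) σ t ω =
      sleDerivRatio κ ω z ((min (t : WithTop ℝ≥0) (σ ω)).untopA) := rfl

/-- `ψ^σ_t = ψ_{t∧σ}` (`rfl`). [folklore] -/
theorem stoppedProcess_slePointPsi_eq (t : ℝ≥0) (ω : ℝ≥0 → ℝ) :
    stoppedProcess (slePointPsi κ z) σ t ω =
      derivRatio (sleDriving κ ω) z ((min (t : WithTop ℝ≥0) (σ ω)).untopA) := rfl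

/-- `1 ≤ ψ^σ` for `σ ≤ ρₙ`. [cite: RohdeSchramm2005, Lemma 6.3 (proof)] -/
theorem one_le_stoppedProcess_slePointPsi (hz : 0 < z.im)
    (hσρ : ∀ ω, σ ω ≤ slePointLocTime κ z n ω) (t : ℝ≥0) (ω : ℝ≥0 → ℝ) :
    1 ≤ stoppedProcess (slePointPsi κ z) σ t ω :=
  one_le_derivRatio (continuous_sleDriving κ ω) hz (coe_untopA_min_lt_swallowingTime hz hσρ t ω)

/-- `ψ^σ_0 = 1`. [folklore] -/
theorem stoppedProcess_slePointPsi_zero (hz : 0 < z.im) (ω : ℝ≥0 → ℝ) :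
    stoppedProcess (slePointPsi κ z) σ 0 ω = 1 := by
  rw [stoppedProcess_eq_of_le (by exact_mod_cast bot_le : ((0 : ℝ≥0) : WithTop ℝ≥0) ≤ σ ω),
    slePointPsi_apply, derivRatio_zero (continuous_sleDriving κ ω) hz]

/-- The rate of (6.3) along the flow, as a function of real time, is the field `4y²/(x²+y²)²`
evaluated at `zₜ`. [folklore] -/
theorem derivRatioRate_eq_loewnerLogDerivRate (W : ℝ≥0 → ℝ) (z : ℂ) (r : ℝ) :
    derivRatioRate W z r =
      loewnerLogDerivRate (centredMap W r.toNNReal z).re (centredMap W r.toNNReal z).im := by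
  rw [derivRatioRate_apply, loewnerLogDerivRate_apply, re_sq_add_im_sq_eq_norm_sq, ← pow_mul,
    centredMap_apply]

/-- **`ψ_{t∧σ} = exp ∫₀ᵗ 𝟙_{s≤σ} 4y_s²/|z_s|⁴ ds`** (pathwise, `σ ≤ ρₙ`): eq. (6.3) read at the
stopped clock (`Loewner.derivRatio_eq_exp`). [cite: RohdeSchramm2005, eq. (6.3)] -/
theorem stoppedProcess_slePointPsi_eq_exp (hz : 0 < z.im)
    (hσρ : ∀ ω, σ ω ≤ slePointLocTime κ z n ω) (t : ℝ≥0) (ω : ℝ≥0 → ℝ) :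
    stoppedProcess (slePointPsi κ z) σ t ω =
      Real.exp (timeIntegral (trunc σ fun s ω ↦ loewnerLogDerivRate
        (stoppedProcess (slePointRe κ z) σ s ω) (stoppedProcess (slePointIm κ z) σ s ω)) t ω) := by
  set u : ℝ≥0 := (min (t : WithTop ℝ≥0) (σ ω)).untopA with hu
  have hW := continuous_sleDriving κ ω
  have huT := coe_untopA_min_lt_swallowingTime hz hσρ t ω
  have hint : timeIntegral (trunc σ fun s ω ↦ loewnerLogDerivRate (stoppedProcess (slePointRe κ z) σ s ω)
      (stoppedProcess (slePointIm κ z) σ s ω)) t ω =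
      ∫ r in (0 : ℝ)..u, derivRatioRate (sleDriving κ ω) z r := by
    rw [timeIntegral_trunc]
    simp only [timeIntegral]
    refine intervalIntegral.integral_congr fun r hr ↦ ?_
    rw [uIcc_of_le (NNReal.coe_nonneg _)] at hr
    have hrσ : ((r.toNNReal : ℝ≥0) : WithTop ℝ≥0) ≤ σ ω := coe_toNNReal_le_of_le_untopA_min hr.2
    have hrT := coe_lt_swallowingTime_of_le_locTime hz (hrσ.trans (hσρ ω))
    simp only [stoppedProcess_eq_of_le hrσ]
    rw [slePointIm_of_lt hrT, slePointRe, derivRatioRate_eq_loewnerLogDerivRate]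
  rw [hint, stoppedProcess_slePointPsi_eq, ← hu, derivRatio_eq_exp hW hz huT]

/-- **`ψ^a_{t∧σ} = 1 + ∫₀ᵗ 𝟙_{s≤σ} a (4y_s²/|z_s|⁴) ψ_s^a ds`** (pathwise, `σ ≤ ρₙ`, any real `a`):
the finite-variation differential `d(ψ^a) = a ψ^a ∂ₜ(log ψ) dt` of the observable's first factor
(`Loewner.derivRatio_rpow_eq` at the stopped clock). [cite: RohdeSchramm2005, eq. (6.3)] -/
theorem stoppedProcess_slePointPsi_rpow_eq_integral (hz : 0 < z.im)
    (hσρ : ∀ ω, σ ω ≤ slePointLocTime κ z n ω) (a : ℝ) (t : ℝ≥0) (ω : ℝ≥0 → ℝ) :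
    stoppedProcess (slePointPsi κ z) σ t ω ^ a =
      1 + timeIntegral (trunc σ fun s ω ↦ a * loewnerLogDerivRate
        (stoppedProcess (slePointRe κ z) σ s ω) (stoppedProcess (slePointIm κ z) σ s ω) *
        stoppedProcess (slePointPsi κ z) σ s ω ^ a) t ω := by
  set u : ℝ≥0 := (min (t : WithTop ℝ≥0) (σ ω)).untopA with hu
  have hW := continuous_sleDriving κ ω
  have huT := coe_untopA_min_lt_swallowingTime hz hσρ t ω
  have hint : timeIntegral (trunc σ fun s ω ↦ a * loewnerLogDerivRate
      (stoppedProcess (slePointRe κ z) σ s ω) (stoppedProcess (slePointIm κ z) σ s ω) *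
        stoppedProcess (slePointPsi κ z) σ s ω ^ a) t ω =
      ∫ r in (0 : ℝ)..u, a * derivRatioRate (sleDriving κ ω) z r *
        derivRatio (sleDriving κ ω) z r.toNNReal ^ a := by
    rw [timeIntegral_trunc]
    simp only [timeIntegral]
    refine intervalIntegral.integral_congr fun r hr ↦ ?_
    rw [uIcc_of_le (NNReal.coe_nonneg _)] at hr
    have hrσ : ((r.toNNReal : ℝ≥0) : WithTop ℝ≥0) ≤ σ ω := coe_toNNReal_le_of_le_untopA_min hr.2
    have hrT := coe_lt_swallowingTime_of_le_locTime hz (hrσ.trans (hσρ ω))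
    simp only [stoppedProcess_eq_of_le hrσ]
    rw [slePointIm_of_lt hrT, slePointRe, slePointPsi_apply, derivRatioRate_eq_loewnerLogDerivRate]
  rw [hint, stoppedProcess_slePointPsi_eq, ← hu, derivRatio_rpow_eq hW hz a huT]

/-- On `[0, ρₙ]` the rate is at most `4 (n+2)²/(im z)²`. [folklore] -/
theorem loewnerLogDerivRate_stopped_le (hz : 0 < z.im) (hσρ : ∀ ω, σ ω ≤ slePointLocTime κ z n ω)
    (t : ℝ≥0) (ω : ℝ≥0 → ℝ) :
    loewnerLogDerivRate (stoppedProcess (slePointRe κ z) σ t ω) (stoppedProcess (slePointIm κ z) σ t ω)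
      ≤ 4 / (z.im / (n + 2)) ^ 2 := by
  have hy := stoppedProcess_slePointIm_pos hz hσρ t ω
  have hlev := level_le_stoppedProcess_slePointIm hz hσρ t ω
  have hl0 := (level_pos_lt hz n).1
  refine (loewnerLogDerivRate_le hy).trans ?_
  exact div_le_div_of_nonneg_left (by norm_num) (pow_pos hl0 2) (pow_le_pow_left₀ hl0.le hlev 2)

/-- **A priori bound for `ψ` on `[0, ρₙ]`**: `ψ_{t∧σ} ≤ exp(4(n+1)(n+2)²/(im z)²)` (the rate is at
most `4(n+2)²/(im z)²` and the clock at most `n + 1`). [folklore] -/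
theorem stoppedProcess_slePointPsi_le (hz : 0 < z.im) (hσρ : ∀ ω, σ ω ≤ slePointLocTime κ z n ω)
    (t : ℝ≥0) (ω : ℝ≥0 → ℝ) :
    stoppedProcess (slePointPsi κ z) σ t ω ≤ Real.exp (4 / (z.im / (n + 2)) ^ 2 * ((n : ℝ) + 1)) := by
  rw [stoppedProcess_slePointPsi_eq_exp hz hσρ, Real.exp_le_exp, timeIntegral_trunc]
  set u : ℝ≥0 := (min (t : WithTop ℝ≥0) (σ ω)).untopA with hu
  have hu1 : (u : ℝ) ≤ (n : ℝ) + 1 := by exact_mod_cast untopA_min_le_nat_add_one hσρ t ω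
  have hC : 0 ≤ 4 / (z.im / (n + 2)) ^ 2 := by positivity
  simp only [timeIntegral]
  have hbound : ∀ r ∈ Set.uIoc (0 : ℝ) u, ‖loewnerLogDerivRate
      (stoppedProcess (slePointRe κ z) σ r.toNNReal ω)
      (stoppedProcess (slePointIm κ z) σ r.toNNReal ω)‖ ≤ 4 / (z.im / (n + 2)) ^ 2 := by
    intro r _
    rw [Real.norm_eq_abs, abs_of_nonneg (loewnerLogDerivRate_nonneg _ _)]
    exact loewnerLogDerivRate_stopped_le hz hσρ _ ω
  have h := intervalIntegral.norm_integral_le_of_norm_le_const hbound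
  rw [Real.norm_eq_abs, sub_zero, abs_of_nonneg (NNReal.coe_nonneg u)] at h
  exact (le_abs_self _).trans (h.trans (mul_le_mul_of_nonneg_left hu1 hC))

/-- `|ψ^a| ≤ exp(4(n+1)(n+2)²/(im z)²)^|a|` on `[0, ρₙ]`, for any real exponent `a`. [folklore] -/
theorem stoppedProcess_slePointPsi_rpow_le (hz : 0 < z.im) (hσρ : ∀ ω, σ ω ≤ slePointLocTime κ z n ω)
    (a : ℝ) (t : ℝ≥0) (ω : ℝ≥0 → ℝ) :
    |stoppedProcess (slePointPsi κ z) σ t ω ^ a| ≤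
      Real.exp (4 / (z.im / (n + 2)) ^ 2 * ((n : ℝ) + 1)) ^ |a| := by
  have h1 := one_le_stoppedProcess_slePointPsi hz hσρ t ω
  have h2 := stoppedProcess_slePointPsi_le hz hσρ t ω
  set ψ := stoppedProcess (slePointPsi κ z) σ t ω
  have hψ : 0 < ψ := by linarith
  rw [abs_of_pos (Real.rpow_pos_of_pos hψ a)]
  calc ψ ^ a ≤ ψ ^ |a| := Real.rpow_le_rpow_of_exponent_le h1 (le_abs_self a)
    _ ≤ _ := Real.rpow_le_rpow hψ.le h2 (abs_nonneg a)

/-- For `a ≤ 0`: `0 < ψ^a ≤ 1` on `[0, ρₙ]`. [cite: RohdeSchramm2005, Lemma 6.3 (proof)] -/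
theorem stoppedProcess_slePointPsi_rpow_mem_Ioc (hz : 0 < z.im)
    (hσρ : ∀ ω, σ ω ≤ slePointLocTime κ z n ω) {a : ℝ} (ha : a ≤ 0) (t : ℝ≥0) (ω : ℝ≥0 → ℝ) :
    stoppedProcess (slePointPsi κ z) σ t ω ^ a ∈ Ioc (0 : ℝ) 1 := by
  have h1 := one_le_stoppedProcess_slePointPsi hz hσρ t ω
  exact ⟨Real.rpow_pos_of_pos (by linarith) a, Real.rpow_le_one_of_one_le_of_nonpos h1 ha⟩

/-- **Every path of `ψ^σ` is continuous** (it is `exp` of a time integral with locally integrable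
integrand). [folklore] -/
theorem continuous_stoppedProcess_slePointPsi (hz : 0 < z.im)
    (hσρ : ∀ ω, σ ω ≤ slePointLocTime κ z n ω) (ω : ℝ≥0 → ℝ) :
    Continuous fun t ↦ stoppedProcess (slePointPsi κ z) σ t ω := by
  have heq : (fun t ↦ stoppedProcess (slePointPsi κ z) σ t ω) = fun t ↦
      Real.exp (timeIntegral (trunc σ fun s ω ↦ loewnerLogDerivRate
        (stoppedProcess (slePointRe κ z) σ s ω) (stoppedProcess (slePointIm κ z) σ s ω)) t ω) :=
    funext fun t ↦ stoppedProcess_slePointPsi_eq_exp hz hσρ t ω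
  rw [heq]
  exact Real.continuous_exp.comp (continuous_timeIntegral fun t ↦
    integrableOn_trunc_loewnerLogDerivRate hz hσρ ω _ isCompact_Icc)

/-- Every path of `(ψ^σ)^a` is continuous. [folklore] -/
theorem continuous_stoppedProcess_slePointPsi_rpow (hz : 0 < z.im)
    (hσρ : ∀ ω, σ ω ≤ slePointLocTime κ z n ω) (a : ℝ) (ω : ℝ≥0 → ℝ) :
    Continuous fun t ↦ stoppedProcess (slePointPsi κ z) σ t ω ^ a :=
  (continuous_stoppedProcess_slePointPsi hz hσρ ω).rpow_const fun t ↦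
    Or.inl (by have := one_le_stoppedProcess_slePointPsi hz hσρ t ω; positivity)

/-- **`ψ^σ` is strongly adapted** for a stopping time `σ ≤ ρₙ` (time integral of a progressive
integrand). [folklore] -/
theorem stronglyAdapted_stoppedProcess_slePointPsi (hz : 0 < z.im)
    (hσ : IsStoppingTime brownianFiltration σ) (hσρ : ∀ ω, σ ω ≤ slePointLocTime κ z n ω) :
    StronglyAdapted brownianFiltration (stoppedProcess (slePointPsi κ z) σ) := by
  have heq : stoppedProcess (slePointPsi κ z) σ = fun t ω ↦
      Real.exp (timeIntegral (trunc σ fun s ω ↦ loewnerLogDerivRate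
        (stoppedProcess (slePointRe κ z) σ s ω) (stoppedProcess (slePointIm κ z) σ s ω)) t ω) :=
    funext fun t ↦ funext fun ω ↦ stoppedProcess_slePointPsi_eq_exp hz hσρ t ω
  rw [heq]
  have hprog := isStronglyProgressive_trunc
    (isStronglyProgressive_loewnerLogDerivRate_stopped (κ := κ) hz hσ) (fun t ↦ hσ.measurableSet_lt t)
  intro t
  exact (Real.measurable_exp.comp (adapted_timeIntegral hprog t)).stronglyMeasurable

/-- `ψ^σ` is progressively measurable. [folklore] -/
theorem isStronglyProgressive_stoppedProcess_slePointPsi (hz : 0 < z.im)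
    (hσ : IsStoppingTime brownianFiltration σ) (hσρ : ∀ ω, σ ω ≤ slePointLocTime κ z n ω) :
    IsStronglyProgressive brownianFiltration (stoppedProcess (slePointPsi κ z) σ) :=
  (stronglyAdapted_stoppedProcess_slePointPsi hz hσ hσρ).isStronglyProgressive_of_continuous
    (continuous_stoppedProcess_slePointPsi hz hσρ)

/-- `(ψ^σ)^a` is strongly adapted. [folklore] -/
theorem stronglyAdapted_stoppedProcess_slePointPsi_rpow (hz : 0 < z.im)
    (hσ : IsStoppingTime brownianFiltration σ) (hσρ : ∀ ω, σ ω ≤ slePointLocTime κ z n ω) (a : ℝ) :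
    StronglyAdapted brownianFiltration fun t ω ↦ stoppedProcess (slePointPsi κ z) σ t ω ^ a := fun t ↦
  ((stronglyAdapted_stoppedProcess_slePointPsi hz hσ hσρ t).measurable.pow_const a).stronglyMeasurable

/-- `(ψ^σ)^a` is progressively measurable. [folklore] -/
theorem isStronglyProgressive_stoppedProcess_slePointPsi_rpow (hz : 0 < z.im)
    (hσ : IsStoppingTime brownianFiltration σ) (hσρ : ∀ ω, σ ω ≤ slePointLocTime κ z n ω) (a : ℝ) :
    IsStronglyProgressive brownianFiltration fun t ω ↦ stoppedProcess (slePointPsi κ z) σ t ω ^ a :=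
  (stronglyAdapted_stoppedProcess_slePointPsi_rpow hz hσ hσρ a).isStronglyProgressive_of_continuous
    (continuous_stoppedProcess_slePointPsi_rpow hz hσρ a)

end Psi

/-! ### `x^σ` is an Itô process -/

section Ito

/-- **The stopped real part `x^σ` is an Itô process** (`σ ≤ ρₙ` a stopping time of the raw
Brownian filtration): `x^σ_t = re z + ∫₀ᵗ 𝟙_{s≤σ} 2x_s/|z_s|² ds + ∫₀ᵗ 𝟙_{s≤σ}(-√κ) dB_s`, driven by
the canonical Brownian motion, with drift `𝟙_{s≤σ} 2x_s/(x_s² + y_s²)` and diffusion coefficient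
`𝟙_{s≤σ}(-√κ)`. Pathwise this is `stoppedProcess_slePointRe_eq_integral`; the stochastic term is the
square-integrable Itô integral of the truncated constant
(`Literature.Probability.Process.exists_isItoIntegral_of_sq_integrable`), indistinguishable from
`-√κ B^σ` (`IsItoIntegral.ae_eq_stoppedProcess`, `isItoIntegral_const_brownian`) — the same
argument as `isItoProcess_stoppedProcess_sleRealFlowStop`. This is "`dxₜ = 2xₜ|zₜ|⁻² dt - dξ(t)`",
`ξ = √κ B` (Rohde–Schramm (2005), pp. 904, 907), localised before `τ(z)`.
[cite: RohdeSchramm2005, Lemma 6.3 (proof)] -/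
theorem isItoProcess_stoppedProcess_slePointRe (hz : 0 < z.im)
    (hσ : IsStoppingTime brownianFiltration σ) (hσρ : ∀ ω, σ ω ≤ slePointLocTime κ z n ω) :
    IsItoProcess (stoppedProcess (slePointRe κ z) σ)
      (trunc σ fun s ω ↦ loewnerReDrift (stoppedProcess (slePointRe κ z) σ s ω)
        (stoppedProcess (slePointIm κ z) σ s ω))
      (trunc σ fun _ _ ↦ -Real.sqrt κ) brownian brownianFiltration preWienerMeasure := by
  haveI := isProbabilityMeasure_preWienerMeasure'
  have hσ' : ∀ t : ℝ≥0, MeasurableSet[brownianFiltration t] {ω | σ ω < t} :=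
    fun t ↦ hσ.measurableSet_lt t
  refine ⟨ae_of_all _ fun ω t ↦ integrableOn_trunc_loewnerReDrift hz hσρ ω _ isCompact_Icc, ?_⟩
  -- the Itô integral of the truncated constant, a square-integrable martingale
  have hσprog : IsStronglyProgressive brownianFiltration
      (trunc σ fun (_ : ℝ≥0) (_ : ℝ≥0 → ℝ) ↦ -Real.sqrt κ) :=
    isStronglyProgressive_trunc (isStronglyProgressive_const _ _) hσ'
  have hfin : ∀ t : ℝ≥0, ∫⁻ ω, (∫⁻ s in Set.Icc (0 : ℝ) t, ENNReal.ofReal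
      ((trunc σ (fun (_ : ℝ≥0) (_ : ℝ≥0 → ℝ) ↦ -Real.sqrt κ)) s.toNNReal ω ^ 2))
      ∂preWienerMeasure ≠ ∞ := by
    intro t
    have hle : ∀ ω : ℝ≥0 → ℝ, (∫⁻ s in Set.Icc (0 : ℝ) t, ENNReal.ofReal
        ((trunc σ (fun (_ : ℝ≥0) (_ : ℝ≥0 → ℝ) ↦ -Real.sqrt κ)) s.toNNReal ω ^ 2)) ≤
        ENNReal.ofReal κ * volume (Set.Icc (0 : ℝ) t) := by
      intro ω
      rw [← setLIntegral_const]
      refine lintegral_mono fun s ↦ ENNReal.ofReal_le_ofReal ?_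
      rw [trunc_apply]
      split_ifs
      · rw [neg_sq, Real.sq_sqrt κ.coe_nonneg]
      · simp
    refine ne_top_of_le_ne_top ?_ (lintegral_mono hle)
    rw [lintegral_const, measure_univ, mul_one, Real.volume_Icc, sub_zero]
    exact ENNReal.mul_ne_top ENNReal.ofReal_ne_top ENNReal.ofReal_ne_top
  obtain ⟨J, hJ, -, -⟩ := exists_isItoIntegral_of_sq_integrable hσprog hfin
  have hJeq := IsItoIntegral.ae_eq_stoppedProcess martingale_brownian_holds
    martingale_brownian_sq_sub_holds memLp_two_brownian continuous_brownian
    (H := fun (_ : ℝ≥0) (_ : ℝ≥0 → ℝ) ↦ -Real.sqrt κ) measurable_const hσ'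
    (isItoIntegral_const_brownian (-Real.sqrt κ)) hJ
  refine ⟨J, hJ, ?_⟩
  filter_upwards [hJeq] with ω hω t
  rw [hω t, stoppedProcess_slePointRe_zero hz]
  exact stoppedProcess_slePointRe_eq_integral hz hσρ t ω

end Ito

end Literature.Probability.RandomPlanarGeometry
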